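import Summits.CriticalPhenomena.PercolationContinuityZ3.Theorems.Transplant.Bcc111ClearedSet
import Summits.CriticalPhenomena.PercolationContinuityZ3.Theorems.Transplant.Bcc111ClawSound
import HarnessLib

/-!
# The bcc (111)-films `F_m(bcc)`, exit-form routing certificate VI: the `K_{2,3}` ELEVATOR HUB of a hub slot, in the film (`m ≥ 6`)

builds on p205010 (kernel theorem, internal audit signed; external expert review pending) — NOT used in this file.
Lane `prim-bschramm`, seat `prim-bschramm-p2` (gen 48; class C1b, METHOD = input substitution; memo `HOME/bschramm/P2-LATTICES.md` §159); helper file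
(`--supports stmt-CriticalPhenomena-4575 --as helper`).  For a hub slot `(Q, i, up)` of the planar model («Bcc111ClawModel».`hubCols`: `b`-column `Q ∓ uᵢ`,
chain-port columns `Q ± u_j`, `Q ± u_k`, exit columns `Q ∓ u_j`, `Q ∓ u_k`) this file builds the SEVEN HUB VERTICES of the film: `y = (Q, h)` and `n = (Q, h ± 3)`
over the hub column (`h` the base level of the column for an up-hub, its top level for a down-hub), `b = (Q ∓ uᵢ, h ± 2)`, the chain ports `p_j = (Q ± u_j, h ± 1)`,
`p_k`, and the first vertices `x_j = (Q ∓ u_j, h ± 2)`, `x_k` of the exit legs — with the `K_{2,3}` adjacencies `y, b ∼ p_j, p_k, n` and `n ∼ x_j, x_k` (two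
vertices of a (111)-film have at most two common neighbours through planar steps; the ELEVATOR `y ∼ n` supplies the third), their columns, their levels in
`[1, m−1]` (but `y`, whose extreme level is admissible because the slot's extreme vertex is not removed) and the membership of `y, b, n` in the rerouting set.
* §1 the up-step vectors of the model (`isUp_uvec`, `uvec_sum`), the columns of a hub slot (`hubCols_pt`);
* §2 `HubFacts` and **`exists_hubFacts`** (`m ≥ 6`).
[cite: DuminilCopinSidoraviciusTassion2016, §2.3 (proof of Fact 2: the three disjoint paths γ_u, γ_v, γ_w)] [cite: ConwaySloane1999, Ch. 4 §7.1]
-/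

noncomputable section

namespace Summit.CriticalPhenomena.PercolationContinuityZ3.Theorems.Transplant

namespace Bcc111

open MeasureTheory Literature.Probability.Percolation Literature.Probability.LatticeModels SimpleGraph
open Slab111 (lev)
open BccClawX (Pt rel)
open Bcc111Claw (tnZ inRB inDB rem0 remM uvec others scale hubCols ClawProps)
open scoped Classical

variable {m : ℕ}

/-! ## §1 The up-step vectors and the columns of a hub slot -/

/-- The model's up-step vectors are up-steps. [folklore] -/
theorem isUp_uvec {i : ℕ} (hi : i ≤ 2) : IsUp (dvec (uvec i)) := by
  interval_cases i
  · exact Or.inl (by simp [dvec, uvec])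
  · exact Or.inr (Or.inl (by simp [dvec, uvec]))
  · exact Or.inr (Or.inr (by simp [dvec, uvec]))

/-- The other two indices are `≤ 2` and the three up-step vectors sum to zero. [folklore] -/
theorem others_spec {i : ℕ} (hi : i ≤ 2) :
    (others i).1 ≤ 2 ∧ (others i).2 ≤ 2 ∧ dvec (uvec i) + dvec (uvec (others i).1) + dvec (uvec (others i).2) = 0 := by
  interval_cases i <;> refine ⟨by simp [others], by simp [others], ?_⟩ <;> ext t <;> fin_cases t <;> simp [others, uvec, dvec]

/-- Columns of scaled differences / sums. [folklore] -/
theorem pt_sub_scale (z : Site 2) (Q v : Pt) (σ : ℤ) : BccClawX.pt z (Q.1 - (scale σ v).1, Q.2 - (scale σ v).2) = BccClawX.pt z Q - σ • dvec v := by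
  ext t; fin_cases t <;> simp [BccClawX.pt, scale, dvec] <;> ring

/-- Columns of scaled sums. [folklore] -/
theorem pt_add_scale (z : Site 2) (Q v : Pt) (σ : ℤ) : BccClawX.pt z (Q.1 + (scale σ v).1, Q.2 + (scale σ v).2) = BccClawX.pt z Q + σ • dvec v := by
  ext t; fin_cases t <;> simp [BccClawX.pt, scale, dvec] <;> ring

/-- **The columns of a hub slot** in `Site 2`: with `σ = ±1`, `bc = Q − σuᵢ`, `F₀ = Q + σu_j`, `F₁ = Q + σu_k`, `X₀ = Q − σu_j`, `X₁ = Q − σu_k`. [folklore] -/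
theorem hubCols_pt (z : Site 2) {Q : Pt} {i : ℕ} {up : Bool} {bc F0 F1 X0 X1 : Pt} (hh : hubCols Q i up = (bc, F0, F1, X0, X1)) :
    let σ : ℤ := if up then 1 else -1
    BccClawX.pt z bc = BccClawX.pt z Q - σ • dvec (uvec i) ∧ BccClawX.pt z F0 = BccClawX.pt z Q + σ • dvec (uvec (others i).1) ∧
      BccClawX.pt z F1 = BccClawX.pt z Q + σ • dvec (uvec (others i).2) ∧ BccClawX.pt z X0 = BccClawX.pt z Q - σ • dvec (uvec (others i).1) ∧
      BccClawX.pt z X1 = BccClawX.pt z Q - σ • dvec (uvec (others i).2) := by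
  simp only [hubCols, Prod.mk.injEq] at hh
  obtain ⟨rfl, rfl, rfl, rfl, rfl⟩ := hh
  exact ⟨pt_sub_scale z Q _ _, pt_add_scale z Q _ _, pt_add_scale z Q _ _, pt_sub_scale z Q _ _, pt_sub_scale z Q _ _⟩

/-! ## §2 The hub vertices -/

/-- **THE HUB VERTICES of a slot** `(Q, bc, F₀, F₁, X₀, X₁)` relative to `z`, for the rerouting set `WR`: `y ≠ b` and `n` in `WR` over `Q`, `bc`, `Q`, the chain ports `p₀, p₁`
over `F₀, F₁` and the exit-leg first vertices `x₀, x₁` over `X₀, X₁`, all but `y` at levels in `[1, m−1]`, with the `K_{2,3}` adjacencies. [cite: DuminilCopinSidoraviciusTassion2016, §2.3 (proof of Fact 2)] -/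
structure HubFacts (m : ℕ) (z : Site 2) (WR : Set (bfilm m)) (Q bc F0 F1 X0 X1 : Pt) (y b n p0 p1 x0 x1 : bfilm m) : Prop where
  yWR : y ∈ WR
  bWR : b ∈ WR
  nWR : n ∈ WR
  y_ne_b : y ≠ b
  y_ne_n : y ≠ n
  b_ne_n : b ≠ n
  shy : rel z (sh y) = Q
  shb : rel z (sh b) = bc
  shn : rel z (sh n) = Q
  shp0 : rel z (sh p0) = F0
  shp1 : rel z (sh p1) = F1
  shx0 : rel z (sh x0) = X0
  shx1 : rel z (sh x1) = X1
  yn : (film m).Adj y n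
  bn : (film m).Adj b n
  yp0 : (film m).Adj y p0
  yp1 : (film m).Adj y p1
  bp0 : (film m).Adj b p0
  bp1 : (film m).Adj b p1
  nx0 : (film m).Adj n x0
  nx1 : (film m).Adj n x1
  levp0 : 1 ≤ lev (pt p0) ∧ lev (pt p0) ≤ (m : ℤ) - 1
  levp1 : 1 ≤ lev (pt p1) ∧ lev (pt p1) ≤ (m : ℤ) - 1
  levx0 : 1 ≤ lev (pt x0) ∧ lev (pt x0) ≤ (m : ℤ) - 1
  levx1 : 1 ≤ lev (pt x1) ∧ lev (pt x1) ≤ (m : ℤ) - 1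
  levn : 1 ≤ lev (pt n) ∧ lev (pt n) ≤ (m : ℤ) - 1
  levb : 1 ≤ lev (pt b) ∧ lev (pt b) ≤ (m : ℤ) - 1

/-- Base levels lie in `[0, 2]`. [folklore] -/
theorem baseLev_range (p : Site 2) : 0 ≤ baseLev p ∧ baseLev p ≤ 2 := by
  unfold baseLev; omega

/-- **THE HUB VERTICES EXIST** (`m ≥ 6`) for every hub slot `(Q, i, up)` whose hub column and `b`-column are rerouting columns and whose extreme vertex over `Q` is
not removed (up-hub: bottom; down-hub: top): up-hub `y = (Q, h)` at the base level `h ∈ [0,2]` of `Q`, `n = (Q, h+3)`, `b = (Q − uᵢ, h+2)`, ports `(Q + u_j, h+1)`,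
`(Q + u_k, h+1)`, exit first vertices `(Q − u_j, h+2)`, `(Q − u_k, h+2)`; down-hub the mirror image from the top level of `Q`. [cite: DuminilCopinSidoraviciusTassion2016, §2.3 (proof of Fact 2)] -/
theorem exists_hubFacts (hm : 6 ≤ m) (z : Site 2) {tR tD sR sD : ℕ} (htRD : tR ≤ tD) (hsRD : sR ≤ sD) {Q : Pt} {i : ℕ} {up : Bool}
    {bc F0 F1 X0 X1 : Pt} (hh : hubCols Q i up = (bc, F0, F1, X0, X1)) (hi : i ≤ 2) (hQ : inRB (min tR 3) (min sR 3) Q = true)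
    (hQ0 : up = true → rem0 (min tR 3) (min sR 3) Q = false) (hQm : up = false → remM (min tR 3) (min sR 3) Q = false)
    (hbc : inRB (min tR 3) (min sR 3) bc = true) :
    ∃ y b n p0 p1 x0 x1 : bfilm m,
      HubFacts m z (clearedSet m z tR tD sR sD ∩ (hexShadow m).lift (blkR 3 z tR sR)) Q bc F0 F1 X0 X1 y b n p0 p1 x0 x1 := by
  have hm' : (6 : ℤ) ≤ m := by exact_mod_cast hm
  have hm1 : 1 ≤ m := le_trans (by norm_num) hm
  obtain ⟨hj, hk, hsum⟩ := others_spec hi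
  set QS : Site 2 := BccClawX.pt z Q with hQS
  set ui : Site 2 := dvec (uvec i)
  set uj : Site 2 := dvec (uvec (others i).1)
  set uk : Site 2 := dvec (uvec (others i).2)
  have hui : IsUp ui := isUp_uvec hi
  have huj : IsUp uj := isUp_uvec hj
  have huk : IsUp uk := isUp_uvec hk
  obtain ⟨ebc, eF0, eF1, eX0, eX1⟩ := hubCols_pt z hh
  have hrel : ∀ {v : bfilm m} {P : Site 2} {p : Pt}, sh v = P → BccClawX.pt z p = P → rel z (sh v) = p := by
    intro v P p hv hp; rw [hv, ← hp, BccClawX.rel_pt]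
  have hb0 := baseLev_range QS
  -- membership helpers
  have memWR : ∀ {v : bfilm m} {p : Pt}, rel z (sh v) = p → inRB (min tR 3) (min sR 3) p = true → 1 ≤ lev (pt v) → lev (pt v) ≤ (m : ℤ) - 1 →
      v ∈ clearedSet m z tR tD sR sD ∩ (hexShadow m).lift (blkR 3 z tR sR) := by
    intro v p hv hp h1 h2; exact mem_WR_of_lev htRD hsRD (by rw [hv]; exact hp) h1 h2
  cases up with
  | true =>
    simp only [if_true, one_smul] at ebc eF0 eF1 eX0 eX1
    set h : ℤ := baseLev QS with hhdef
    have hay : Adm m QS h := adm_baseLev (le_trans (by norm_num) hm) QS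
    have han : Adm m QS (h + 3) := adm_elev hay (by omega)
    have hap0 : Adm m (QS + uj) (h + 1) := adm_up hay huj (by omega)
    have hap1 : Adm m (QS + uk) (h + 1) := adm_up hay huk (by omega)
    have hebc : QS + uj + uk = QS - ui := by
      have : ui + uj + uk = 0 := hsum
      rw [show QS - ui = QS + (uj + uk) - (ui + uj + uk) by abel, this, sub_zero, add_assoc]
    have hab : Adm m (QS - ui) (h + 2) := by
      have := adm_up hap0 huk (by omega); rwa [hebc, show h + 1 + 1 = h + 2 by ring] at this
    have hax0 : Adm m (QS - uj) (h + 3 - 1) := adm_down han huj (by omega)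
    have hax1 : Adm m (QS - uk) (h + 3 - 1) := adm_down han huk (by omega)
    refine ⟨vtx m QS h, vtx m (QS - ui) (h + 2), vtx m QS (h + 3), vtx m (QS + uj) (h + 1), vtx m (QS + uk) (h + 1),
      vtx m (QS - uj) (h + 3 - 1), vtx m (QS - uk) (h + 3 - 1), ?_⟩
    refine ⟨?_, memWR (hrel (sh_vtx hab) ebc) hbc (by rw [lev_vtx hab]; omega) (by rw [lev_vtx hab]; omega),
      memWR (hrel (sh_vtx han) rfl) hQ (by rw [lev_vtx han]; omega) (by rw [lev_vtx han]; omega), ?_, ?_, ?_,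
      hrel (sh_vtx hay) rfl, hrel (sh_vtx hab) ebc, hrel (sh_vtx han) rfl, hrel (sh_vtx hap0) eF0, hrel (sh_vtx hap1) eF1,
      hrel (sh_vtx hax0) eX0, hrel (sh_vtx hax1) eX1, adj_vtx_elev hay (by omega), ?_, adj_vtx_up hay huj (by omega), adj_vtx_up hay huk (by omega),
      ?_, ?_, ?_, ?_, by rw [lev_vtx hap0]; omega, by rw [lev_vtx hap1]; omega, by rw [lev_vtx hax0]; omega, by rw [lev_vtx hax1]; omega,
      by rw [lev_vtx han]; omega, by rw [lev_vtx hab]; omega⟩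
    · -- `y ∈ WR`: level `h ∈ [0,2]`; if `h = 0` the bottom vertex over `Q` is not removed
      rw [mem_WR_iff htRD hsRD, hrel (sh_vtx hay) rfl, lev_vtx hay]
      exact ⟨hQ, fun hc => by rw [hQ0 rfl] at hc; exact Bool.false_ne_true hc.2, fun hc => by omega⟩
    · intro e; have := congrArg (fun v : bfilm m => lev (pt v)) e; simp only [lev_vtx hay, lev_vtx hab] at this; omega
    · intro e; have := congrArg (fun v : bfilm m => lev (pt v)) e; simp only [lev_vtx hay, lev_vtx han] at this; omega
    · intro e; have := congrArg (fun v : bfilm m => lev (pt v)) e; simp only [lev_vtx hab, lev_vtx han] at this; omega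
    · -- `b ∼ n`: `n = b + uᵢ`
      have := adj_vtx_up hab hui (by omega)
      rwa [sub_add_cancel, show h + 2 + 1 = h + 3 by ring] at this
    · -- `b ∼ p₀`: `b = p₀ + u_k`
      have := adj_vtx_up hap0 huk (by omega)
      rw [hebc, show h + 1 + 1 = h + 2 by ring] at this; exact this.symm
    · -- `b ∼ p₁`: `b = p₁ + u_j`
      have := adj_vtx_up hap1 huj (by omega)
      rw [show QS + uk + uj = QS + uj + uk by abel, hebc, show h + 1 + 1 = h + 2 by ring] at this; exact this.symm
    · -- `n ∼ x₀`: `n = x₀ + u_j`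
      have := adj_vtx_up hax0 huj (by omega)
      rw [sub_add_cancel, show h + 3 - 1 + 1 = h + 3 by ring] at this; exact this.symm
    · have := adj_vtx_up hax1 huk (by omega)
      rw [sub_add_cancel, show h + 3 - 1 + 1 = h + 3 by ring] at this; exact this.symm
  | false =>
    simp only [Bool.false_eq_true, if_false, neg_smul, one_smul, sub_neg_eq_add] at ebc eF0 eF1 eX0 eX1
    -- the top level `h ∈ [m−2, m]` of the hub column
    set h : ℤ := baseLev QS + 3 * (((m : ℤ) - baseLev QS) / 3) with hhdef
    have hrange : (m : ℤ) - 2 ≤ h ∧ h ≤ m := by omega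
    have hay : Adm m QS h := adm_of_dvd (adm_baseLev (le_trans (by norm_num) hm) QS) ⟨((m : ℤ) - baseLev QS) / 3, by omega⟩ (by omega) hrange.2
    have han : Adm m QS (h - 3) := adm_of_dvd hay ⟨-1, by ring⟩ (by omega) (by omega)
    have hap0 : Adm m (QS - uj) (h - 1) := adm_down hay huj (by omega)
    have hap1 : Adm m (QS - uk) (h - 1) := adm_down hay huk (by omega)
    have hebc : QS - uj - uk = QS + ui := by
      have : ui + uj + uk = 0 := hsum
      rw [show QS + ui = QS - (uj + uk) + (ui + uj + uk) by abel, this, add_zero, sub_sub]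
    have hab : Adm m (QS + ui) (h - 2) := by
      have := adm_down hap0 huk (by omega); rwa [hebc, show h - 1 - 1 = h - 2 by ring] at this
    have hax0 : Adm m (QS + uj) (h - 3 + 1) := adm_up han huj (by omega)
    have hax1 : Adm m (QS + uk) (h - 3 + 1) := adm_up han huk (by omega)
    refine ⟨vtx m QS h, vtx m (QS + ui) (h - 2), vtx m QS (h - 3), vtx m (QS - uj) (h - 1), vtx m (QS - uk) (h - 1),
      vtx m (QS + uj) (h - 3 + 1), vtx m (QS + uk) (h - 3 + 1), ?_⟩
    refine ⟨?_, memWR (hrel (sh_vtx hab) (by rw [ebc])) hbc (by rw [lev_vtx hab]; omega) (by rw [lev_vtx hab]; omega),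
      memWR (hrel (sh_vtx han) rfl) hQ (by rw [lev_vtx han]; omega) (by rw [lev_vtx han]; omega), ?_, ?_, ?_,
      hrel (sh_vtx hay) rfl, hrel (sh_vtx hab) (by rw [ebc]), hrel (sh_vtx han) rfl, hrel (sh_vtx hap0) (by rw [eF0, sub_eq_add_neg]),
      hrel (sh_vtx hap1) (by rw [eF1, sub_eq_add_neg]), hrel (sh_vtx hax0) eX0, hrel (sh_vtx hax1) eX1, ?_, ?_, ?_, ?_, ?_, ?_, ?_, ?_,
      by rw [lev_vtx hap0]; omega, by rw [lev_vtx hap1]; omega, by rw [lev_vtx hax0]; omega, by rw [lev_vtx hax1]; omega,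
      by rw [lev_vtx han]; omega, by rw [lev_vtx hab]; omega⟩
    · -- `y ∈ WR`: level `h ∈ [m−2, m]`; if `h = m` the top vertex over `Q` is not removed
      rw [mem_WR_iff htRD hsRD, hrel (sh_vtx hay) rfl, lev_vtx hay]
      exact ⟨hQ, fun hc => by omega, fun hc => by rw [hQm rfl] at hc; exact Bool.false_ne_true hc.2⟩
    · intro e; have := congrArg (fun v : bfilm m => lev (pt v)) e; simp only [lev_vtx hay, lev_vtx hab] at this; omega
    · intro e; have := congrArg (fun v : bfilm m => lev (pt v)) e; simp only [lev_vtx hay, lev_vtx han] at this; omega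
    · intro e; have := congrArg (fun v : bfilm m => lev (pt v)) e; simp only [lev_vtx hab, lev_vtx han] at this; omega
    · -- `y ∼ n` (elevator from `n`)
      have := adj_vtx_elev han (by omega); rw [sub_add_cancel] at this; exact this.symm
    · -- `b ∼ n`: `b = n + uᵢ`
      have := adj_vtx_up han hui (by omega)
      rw [show h - 3 + 1 = h - 2 by ring] at this; exact this.symm
    · -- `y ∼ p₀`
      exact adj_vtx_down hay huj (by omega)
    · exact adj_vtx_down hay huk (by omega)
    · -- `b ∼ p₀`: `b = p₀ − u_k`
      have := adj_vtx_down hap0 huk (by omega)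
      rw [hebc, show h - 1 - 1 = h - 2 by ring] at this; exact this.symm
    · have := adj_vtx_down hap1 huj (by omega)
      rw [show QS - uk - uj = QS - uj - uk by abel, hebc, show h - 1 - 1 = h - 2 by ring] at this; exact this.symm
    · -- `n ∼ x₀`: `x₀ = n + u_j`
      exact adj_vtx_up han huj (by omega)
    · exact adj_vtx_up han huk (by omega)

end Bcc111

end Summit.CriticalPhenomena.PercolationContinuityZ3.Theorems.Transplant

end
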